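import Literature.AlgebraicGeometry.AbelianSchemes.PolarizedLevelLocusTower
import Literature.AlgebraicGeometry.AbelianSchemes.PolarizationOfLDeltaCubeLocusAmple
import Literature.AlgebraicGeometry.AbelianSchemes.LDeltaCubeLocusLinearSystem
import Literature.AlgebraicGeometry.AbelianSchemes.DescendedHomBaseChangeComp
import Literature.AlgebraicGeometry.KTheory.PullbackVectorBundle
import Literature.AlgebraicGeometry.Modules.PushforwardBaseChangeHomComp
import Literature.AlgebraicGeometry.Resolution.ResolutionCharZero
import HarnessLib

/-!
# The MFK locus tower of an abelian scheme with a rank-one module and `2g` sections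
# ([MumfordFogartyKirwan1994] Prop. 7.3, steps (III)–(VI), below the group law)

Topic `AlgebraicGeometry/AbelianSchemes`; namespace `Literature.AlgebraicGeometry.AbelianSchemes.AbelianSchemeOver`; universe `0`
(the (VI) storey ★ `LDeltaCubeLocusLinearSystem` and the (V) closer ★ `PolarizationOfLDeltaCubeLocus[Ample]` are universe-0).
Cell hodgecm-mathlib (D-0151), F-DAG leaf F-6, CAPSTONE FILE 1 (census `B-provers/B-p18/g19/CENSUS-F6-Capstone-MFKSubfunctorOfHilb.B-p18g19.md`,
B-p02 (g14) bytes; FILE 2 `MFKSubfunctorOfHilb` prepends steps (I)–(II)).  THEOREMS ONLY; books 0.  HC_CM is proved only modulo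
the 7 printed citations until rung 0 closes; this file discharges none of them.

SETTING (= the data MFK's `H₂` carries, p. 133).  `S` locally of finite type over a countable field `F` of characteristic `0`
(`f : S ⟶ Spec F`), `A → S` an abelian scheme of relative dimension `g` WITH ITS GROUP LAW, a dual pair `D = (Â, 𝒫)` with the unit
clause `hD` (the F-3 datum), a rank-one module `L₀` on `A` («`𝒪(1)|_A`»), `2g` sections `σᵢ ∈ A(S)`, a level `N ≠ 0`, a polarisation
type `δ`, and a frame `u : 𝒪_S^{6^g·deg δ} ⟶ π_*L₀` (the coordinate sections).  Write `L′ := L₀ ⊗ π^*(ε^*L₀)^∨` (★ (γ) §1) and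
`Λ(L′) : A → Â` for its classifying homomorphism (★ (γ) §5).  MFK cuts `H₆ ⊂ H₅ ⊂ H₄ ⊂ H₃ ⊂ H₂` by: (III)–(IV) «the `σᵢ` are a
level-`N` structure», (V) «`L′ ⊗ 𝒪_T ≅ L^Δ(ω)^{⊗3}` for a homomorphism `ω` with `[6] ≫ ω = Λ(L′)_T`» (Prop. 6.11), then «`Z₅` has a
polarization `ω̄₅`», App. 7A / [Lan2013PELCompactifications, Cor. 1.3.6.7] «type `δ`, symplectic-liftable» (open and closed), and
(VI) «the embedding is the complete linear system».  The tree holds every storey as a representability statement with `b`-INTRINSIC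
clause: ★ (V) `exists_classify_and_LDelta_cube_locus`, ★ (P) `exists_polarization_lam_eq_of_LDelta_cube_of_fibrewise_ample` (the polarisation at
ANY `b : T → S` in the (V)-locus, from fibrewise ampleness of `L₀`), ★ tower (a) `exists_isImmersion_iff_existsUnique_symplecticLevel` ((III)+(IV)+(V′) over a base
carrying a polarisation), ★ (VI) `exists_opens_iff_isIso_comp_pushforwardBaseChangeHom_of_LDelta_cube`.
* §1 **`exists_isImmersion_iff_mfkLocus_of_transport`** — THE TOWER: there is an immersion `j : H ⟶ S` such that a morphism
  `b : T ⟶ S` from a locally Noetherian `T` factors through `j`, and then uniquely, iff ON `A ×_S T`: the (V)-clause holds with its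
  homomorphism `ω`, SOME polarisation `λ_T` with `λ_T = ω` has type `δ`, the `σᵢ ×_S T` are a level-`N` structure symplectic-liftable
  of type `δ` for `λ_T`, and `b^*u ≫ β` frames `(π_T)_*(L₀|_{A_T})` — modulo the two TRANSPORT inputs of census F5: (S2) «for
  `v ≫ j₅ = b` the type / level / liftability clauses of `(A ×_S H₅) ×_{H₅} T` (polarisation `ω₅ ×_{H₅} T`) and of `A ×_S T`
  (polarisation `ω_b`) agree» and (T2-mod) «`IsIso (v^*(j₅^*u ≫ β₁) ≫ β) ↔ IsIso ((v ≫ j₅)^*u ≫ β_{paste})`», taken as hypotheses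
  in their tree letters (★-candidates `DescendedHomBaseChangeComp`, `Modules/PushforwardBaseChangeHomComp`).
  Construction `H := W ↪ H_a ↪ H₅ ↪ S`: ★ (V) over `S`; ★ (P) at `b := j₅`; ★ tower (a) over `H₅`; ★ (VI) over `H_a` at
  `b := j_a ≫ j₅` with the polarisation of ★ (P) there and `hT` transported by (S2); composition by ★ (T1) `existsUnique_fac_comp_iff`.
* §2 **`exists_isImmersion_iff_mfkLocus`** — the same, hypothesis-free: (S2) is ★ `hasType_iff_and_exists_isSymplecticLiftable_iff_of_pow_six_comp_eq`
  (`DescendedHomBaseChangeComp`, B-p12 (g16)) and (T2-mod) is ★ `Modules/PushforwardBaseChangeHomComp` (B-p01 (g14)).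
* §3 **`mfkLocus_self_of_forall_iff`** — (T3): the clauses hold at `b := j` itself, i.e. the universal polarised abelian scheme
  with symplectic level structure of type `δ` over the locus (F-8 (8α) `univ`).

## References
* [MumfordFogartyKirwan1994] D. Mumford, J. Fogarty, F. Kirwan, *Geometric Invariant Theory*, 3rd ed. (1994), Ch. 7 §2
  Definition 7.1–7.2 (p. 129), Proposition 7.3 and its proof, steps (III)–(VI) (pp. 133–134); Ch. 6 §2 Prop. 6.11 (p. 122);
  App. 7A (pp. 234–235).
* [Lan2013PELCompactifications] K.-W. Lan, *Arithmetic compactifications of PEL-type Shimura varieties* (2013), §1.3.6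
  Lemma 1.3.6.6 and Cor. 1.3.6.7 (pp. 81–82).
-/

noncomputable section

open CategoryTheory CategoryTheory.Limits AlgebraicGeometry MonoidalCategory Cardinal

namespace Literature.AlgebraicGeometry.AbelianSchemes

namespace AbelianSchemeOver

open Literature.AlgebraicGeometry.Motives Literature.AlgebraicGeometry.ModuliOfAbelianVarieties
  Literature.AlgebraicGeometry.Modules Literature.AlgebraicGeometry.AbelianVarieties
open scoped MonObj

/-! ### §0 Plumbing -/

/-- An immersion is a monomorphism of schemes (closed immersion followed by an open immersion). [folklore] -/
private theorem mono_of_isImmersion' {X Y : Scheme.{0}} (f : X ⟶ Y) [IsImmersion f] : Mono f := by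
  rw [← f.liftCoborder_ι]
  exact mono_comp _ _

/-- The residue fields of a scheme over a field of characteristic `0` have every positive integer invertible
(★ `Resolution.charZero_residueField_of_over_field`). [folklore] -/
private theorem forall_natCast_residueField_ne_zero_of_over_field {F : Type} [Field F] [CharZero F] {S : Scheme.{0}}
    (f : S ⟶ Spec (.of F)) : ∀ M : ℕ, M ≠ 0 → ∀ s : S, (M : S.residueField s) ≠ 0 := fun M hM s => by
  haveI := Resolution.charZero_residueField_of_over_field f s
  exact Nat.cast_ne_zero.2 hM

/-! ### §1 The tower, modulo the two transports -/

section Tower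

variable {F : Type} [Field F] [CharZero F] (hF : #F ≤ ℵ₀) {S : Scheme.{0}} (f : S ⟶ Spec (.of F))
  [LocallyOfFiniteType f] (A : AbelianSchemeOver S) {g : ℕ} (hg : A.IsOfRelDim g) (D : A.DualPair)
  (hD : Nonempty ((Scheme.Modules.pullback (DualPair.unitHatSlice D)).obj D.P ≅ SheafOfModules.unit _))
  (L₀ : A.left.Modules) (hL₀ : HasRank L₀ 1)
  (hamp : ∀ ⦃Ω : Type⦄ [Field Ω] [IsAlgClosed Ω] (s : Spec (.of Ω) ⟶ S),
    ∃ Θ : CartierDivisor (A.fibre s).toAbelianVariety.X.left, Θ.IsAmple ∧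
      Nonempty ((Scheme.Modules.pullback (X := (A.fibre s).toAbelianVariety.X.left) (pullback.fst A.X.hom s)).obj L₀ ≅
        A.lineBundleOfDivisor s Θ))
  {N : ℕ} (hN : N ≠ 0) (δ : Fin g → ℕ) (hδ : IsPolarizationType δ) (σ : Fin g ⊕ Fin g → A.Sections)
  (u : freeModule S (Fin (6 ^ g * polarizationDegree δ)) ⟶ (Scheme.Modules.pushforward A.X.hom).obj L₀)

include hF f hg hD hL₀ hamp hN hδ in
set_option backward.isDefEq.respectTransparency false in
/-- **THE MFK LOCUS TOWER (steps (III)–(VI)) OF AN ABELIAN SCHEME, modulo the two transports (S2) and (T2-mod).**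
See the module docstring; `hS2` is the census-F5 seam (S2) in its tree letter (an `iff` between the clause read
on `(A ×_S S₁) ×_{S₁} T` along `v` and the clause read on `A ×_S T` along `b = v ≫ j`, for a closed immersion `j : S₁ ⟶ S` and sixth
roots `ω₁`, `ω` of `Λ(L′)` over `S₁`, `T`).
[cite: MumfordFogartyKirwan1994, Ch. 7 §2 Proposition 7.3 (pp. 132–134)]
[cite: MumfordFogartyKirwan1994, Ch. 7 §2 Proposition 7.3 (pp. 133–134) and App. 7A (pp. 234–235)]
[cite: Lan2013PELCompactifications, §1.3.6 Lemma 1.3.6.6 and Cor. 1.3.6.7 (pp. 81–82)] -/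
theorem exists_isImmersion_iff_mfkLocus_of_transport
    (hS2 : ∀ ⦃S₁ T : Scheme.{0}⦄ [IsLocallyNoetherian T] (j : S₁ ⟶ S) (v : T ⟶ S₁) (b : T ⟶ S) (_ : v ≫ j = b)
      (lam : A.X ⟶ D.hat.X) (_ : IsMonHom lam)
      (pol₁ : (A.baseChange j).Polarization (D.baseChange j))
      (_ : ((𝟙 (A.baseChange j).X) ^ 6) ≫ pol₁.lam = (Over.pullback j).map lam)
      (pol : (A.baseChange b).Polarization (D.baseChange b))
      (_ : ((𝟙 (A.baseChange b).X) ^ 6) ≫ pol.lam = (Over.pullback b).map lam),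
      ((pol₁.baseChange v).HasType δ ↔ pol.HasType δ) ∧
        ((∃ φ₁ : LevelStructure g N ((A.baseChange j).baseChange v),
            (∀ i, φ₁.σ i = (A.baseChange j).sectionBaseChange v (A.sectionBaseChange j (σ i))) ∧
              φ₁.IsSymplecticLiftable (pol₁.baseChange v) δ) ↔
          ∃ φ : LevelStructure g N (A.baseChange b),
            (∀ i, φ.σ i = A.sectionBaseChange b (σ i)) ∧ φ.IsSymplecticLiftable pol δ)) :
    ∃ (lam : A.X ⟶ D.hat.X) (_ : IsMonHom lam)
      (_ : ∀ ⦃U : Over S⦄ (a : U ⟶ A.X),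
        Nonempty ((Scheme.Modules.pullback (A.X ◁ (a ≫ lam)).left).obj D.P ≅
          (Scheme.Modules.pullback (A.X ◁ a).left).obj (A.mumfordBundle
            (tensorObj L₀ ((Scheme.Modules.pullback A.X.hom).obj
              (Modules.dual ((Scheme.Modules.pullback A.unitSection).obj L₀)))))))
      (H : Scheme.{0}) (j : H ⟶ S), IsImmersion j ∧
      ∀ ⦃T : Scheme.{0}⦄ [IsLocallyNoetherian T] (b : T ⟶ S),
        (∃! v : T ⟶ H, v ≫ j = b) ↔
          ∃ (ω : (A.baseChange b).X ⟶ (D.hat.baseChange b).X) (Γ₁ : (A.baseChange b).left ⟶ A.prodLeft D.hat),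
            IsMonHom ω ∧ ((𝟙 (A.baseChange b).X) ^ 6) ≫ ω = (Over.pullback b).map lam ∧
              Γ₁ ≫ pullback.fst A.X.hom D.hat.X.hom = pullback.fst A.X.hom b ∧
              Γ₁ ≫ pullback.snd A.X.hom D.hat.X.hom = ω.left ≫ pullback.fst D.hat.X.hom b ∧
              Nonempty ((Scheme.Modules.pullback (pullback.fst A.X.hom b)).obj
                  (tensorObj L₀ ((Scheme.Modules.pullback A.X.hom).obj
                    (Modules.dual ((Scheme.Modules.pullback A.unitSection).obj L₀)))) ≅
                tensorPow ((Scheme.Modules.pullback Γ₁).obj D.P) 3) ∧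
              ∃ pol : (A.baseChange b).Polarization (D.baseChange b), pol.lam = ω ∧ pol.HasType δ ∧
                (∃ φ : LevelStructure g N (A.baseChange b),
                  (∀ i, φ.σ i = A.sectionBaseChange b (σ i)) ∧ φ.IsSymplecticLiftable pol δ) ∧
                IsIso ((Scheme.Modules.pullback b).map u ≫
                  pushforwardBaseChangeHom (IsPullback.of_hasPullback A.X.hom b).w L₀) := by
  classical
  haveI : IsLocallyNoetherian S := LocallyOfFiniteType.isLocallyNoetherian f
  have hQ : ∀ M : ℕ, M ≠ 0 → ∀ s : S, (M : S.residueField s) ≠ 0 :=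
    forall_natCast_residueField_ne_zero_of_over_field f
  have h6 : ∀ s : S, (6 : S.residueField s) ≠ 0 := fun s => by exact_mod_cast hQ 6 (by norm_num) s
  -- (V): the closed locus `j₅ : H₅ ⟶ S` and the classifying homomorphism `lam = Λ(L′)`
  obtain ⟨lam, hmon, hlam, H₅, j₅, hj₅, H5⟩ := A.exists_classify_and_LDelta_cube_locus D hD L₀ hL₀ h6
  haveI := hmon
  haveI := hj₅
  refine ⟨lam, hmon, hlam, ?_⟩
  -- the (V)-data over `H₅` itself (`b := j₅`, `v := 𝟙`)
  obtain ⟨ω₅, Γ₅, hω₅m, hω₅, hΓ₅₁, hΓ₅₂, ⟨e₅⟩⟩ := (H5 j₅).1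
    ⟨𝟙 H₅, Category.id_comp _, fun v hv => (cancel_mono j₅).1 (hv.trans (Category.id_comp _).symm)⟩
  haveI := hω₅m
  -- (P): the polarisation `pol₅` of `A ×_S H₅` with `pol₅.lam = ω₅`
  obtain ⟨pol₅, hpol₅⟩ := exists_polarization_lam_eq_of_LDelta_cube_of_fibrewise_ample hF f A D hD hg L₀ hL₀ lam hlam hamp
    j₅ ω₅ hω₅ (hasRank_pullback Γ₅ D.hasRank_one) ⟨e₅⟩
  -- tower (a) over `H₅`: the immersion `j_a : H_a ⟶ H₅`
  haveI : IsLocallyNoetherian H₅ := LocallyOfFiniteType.isLocallyNoetherian j₅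
  have hQ₅ : ∀ M : ℕ, M ≠ 0 → ∀ x : H₅, (M : H₅.residueField x) ≠ 0 := fun M hM x =>
    natCast_residueField_ne_zero_of_hom j₅ (hQ M hM) x
  obtain ⟨Ha, ja, hja, HA⟩ := (A.baseChange j₅).exists_isImmersion_iff_existsUnique_symplecticLevel pol₅ δ
    (hg.baseChange j₅) hQ₅ hδ hN (fun i => A.sectionBaseChange j₅ (σ i))
  haveI := hja
  haveI : Mono ja := mono_of_isImmersion' ja
  haveI : Mono (ja ≫ j₅) := mono_comp _ _
  -- (V)-data and the polarisation at `b := j_a ≫ j₅`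
  obtain ⟨ωa, Γa, hωam, hωa, hΓa₁, hΓa₂, ⟨ea⟩⟩ := (H5 (ja ≫ j₅)).1 ⟨ja, rfl, fun v hv => (cancel_mono j₅).1 hv⟩
  haveI := hωam
  obtain ⟨pola, hpola⟩ := exists_polarization_lam_eq_of_LDelta_cube_of_fibrewise_ample hF f A D hD hg L₀ hL₀ lam hlam hamp
    (ja ≫ j₅) ωa hωa (hasRank_pullback Γa D.hasRank_one) ⟨ea⟩
  -- its type, transported by (S2) from tower (a) at `𝟙`
  have hpol₅' : ((𝟙 (A.baseChange j₅).X) ^ 6) ≫ pol₅.lam = (Over.pullback j₅).map lam := by rw [hpol₅]; exact hω₅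
  have hpola' : ((𝟙 (A.baseChange (ja ≫ j₅)).X) ^ 6) ≫ pola.lam = (Over.pullback (ja ≫ j₅)).map lam := by
    rw [hpola]; exact hωa
  haveI : IsLocallyNoetherian Ha := LocallyOfFiniteType.isLocallyNoetherian ja
  obtain ⟨φa, hφa, hTa5, hLa5⟩ := (HA ja).1
    ⟨𝟙 Ha, Category.id_comp _, fun v hv => (cancel_mono ja).1 (hv.trans (Category.id_comp _).symm)⟩
  have hTa : pola.HasType δ := (hS2 j₅ ja (ja ≫ j₅) rfl lam hmon pol₅ hpol₅' pola hpola').1.1 hTa5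
  -- (VI) over `H_a`: the open `W ⊆ H_a`
  have hQa : ∀ M : ℕ, M ≠ 0 → ∀ x : Ha, (M : Ha.residueField x) ≠ 0 := fun M hM x =>
    natCast_residueField_ne_zero_of_hom (ja ≫ j₅) (hQ M hM) x
  obtain ⟨efree⟩ := KTheory.nonempty_pullbackFreeIso (ja ≫ j₅) (Fin (6 ^ g * polarizationDegree δ))
  obtain ⟨W, hW⟩ := A.exists_opens_iff_isIso_comp_pushforwardBaseChangeHom_of_LDelta_cube D L₀ hL₀ (ja ≫ j₅) pola Γa hΓa₁
    (by rw [hpola]; exact hΓa₂) ⟨ea⟩ hg hQa hTa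
    (efree.inv ≫ (Scheme.Modules.pullback (ja ≫ j₅)).map u ≫
      pushforwardBaseChangeHom (IsPullback.of_hasPullback A.X.hom (ja ≫ j₅)).w L₀)
  -- the (VI)-clause over `H_a` along `v_a` IS the (VI)-clause over `S` along `v_a ≫ j_a ≫ j₅` (★ pasting law)
  have hVI : ∀ {T : Scheme.{0}} (va : T ⟶ Ha),
      (∃ c' : T ⟶ (W : Scheme.{0}), c' ≫ W.ι = va) ↔
        IsIso ((Scheme.Modules.pullback (va ≫ ja ≫ j₅)).map u ≫
          pushforwardBaseChangeHom (IsPullback.of_hasPullback A.X.hom (va ≫ ja ≫ j₅)).w L₀) := by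
    intro T va
    have hsq : IsPullback (pullback.lift (pullback.fst A.X.hom (va ≫ ja ≫ j₅))
        (pullback.snd A.X.hom (va ≫ ja ≫ j₅) ≫ va) (by rw [Category.assoc]; exact pullback.condition))
        (pullback.snd A.X.hom (va ≫ ja ≫ j₅)) (A.baseChange (ja ≫ j₅)).X.hom va :=
      IsPullback.of_right (by rw [pullback.lift_fst]; exact IsPullback.of_hasPullback A.X.hom (va ≫ ja ≫ j₅))
        (pullback.lift_snd _ _ _) (IsPullback.of_hasPullback A.X.hom (ja ≫ j₅))
    rw [hW va hsq, Functor.map_comp, Category.assoc ((Scheme.Modules.pullback va).map efree.inv),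
      isIso_comp_left_iff,
      isIso_pullback_map_comp_pushforwardBaseChangeHom_iff_of_isPullback_paste_horiz
        (IsPullback.of_hasPullback A.X.hom (ja ≫ j₅)) hsq L₀ u]
    exact isIso_pullback_map_comp_pushforwardBaseChangeHom_iff_of_eq_fst _ _ (pullback.lift_fst _ _ _) L₀ u
  -- the tower
  refine ⟨(W : Scheme.{0}), W.ι ≫ ja ≫ j₅, inferInstance, fun T _ b => ?_⟩
  rw [existsUnique_fac_comp_iff (ja ≫ j₅) W.ι b]
  constructor
  · -- (→): from a factorisation, read every clause on `A ×_S T`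
    rintro ⟨va, hva, hw⟩
    subst hva
    -- (V) at `b`
    obtain ⟨ω, Γ₁, hωm, hω, hΓ₁₁, hΓ₁₂, e⟩ := (H5 (va ≫ ja ≫ j₅)).1 ⟨va ≫ ja, Category.assoc _ _ _,
      fun v hv => (cancel_mono j₅).1 (hv.trans (Category.assoc va ja j₅).symm)⟩
    haveI := hωm
    -- (P) at `b`
    obtain ⟨pol, hpol⟩ := exists_polarization_lam_eq_of_LDelta_cube_of_fibrewise_ample hF f A D hD hg L₀ hL₀ lam hlam hamp
      (va ≫ ja ≫ j₅) ω hω (hasRank_pullback Γ₁ D.hasRank_one) e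
    have hpol' : ((𝟙 (A.baseChange (va ≫ ja ≫ j₅)).X) ^ 6) ≫ pol.lam = (Over.pullback (va ≫ ja ≫ j₅)).map lam := by
      rw [hpol]; exact hω
    -- tower (a) at `v₅ := v_a ≫ j_a`, transported by (S2)
    obtain ⟨φ₁, hφ₁, hT₁, hL₁⟩ := (HA (va ≫ ja)).1 ⟨va, rfl, fun v hv => (cancel_mono ja).1 hv⟩
    obtain ⟨hS2T, hS2L⟩ := hS2 j₅ (va ≫ ja) (va ≫ ja ≫ j₅) (Category.assoc _ _ _) lam hmon pol₅ hpol₅' pol hpol'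
    obtain ⟨φ, hφ, hLφ⟩ := hS2L.1 ⟨φ₁, hφ₁, hL₁⟩
    exact ⟨ω, Γ₁, hωm, hω, hΓ₁₁, hΓ₁₂, e, pol, hpol, hS2T.1 hT₁, ⟨φ, hφ, hLφ⟩, (hVI va).1 hw.exists⟩
  · -- (←): from the clauses on `A ×_S T`, factor through every storey
    rintro ⟨ω, Γ₁, hωm, hω, hΓ₁₁, hΓ₁₂, e, pol, hpol, hT, hφ, hVI'⟩
    haveI := hωm
    have hpol' : ((𝟙 (A.baseChange b).X) ^ 6) ≫ pol.lam = (Over.pullback b).map lam := by rw [hpol]; exact hω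
    -- through `H₅`
    obtain ⟨v₅, hv₅, -⟩ := (H5 b).2 ⟨ω, Γ₁, hωm, hω, hΓ₁₁, hΓ₁₂, e⟩
    -- through `H_a` (transport by (S2))
    obtain ⟨hS2T, hS2L⟩ := hS2 j₅ v₅ b hv₅ lam hmon pol₅ hpol₅' pol hpol'
    obtain ⟨φ₁, hφ₁, hL₁⟩ := hS2L.2 hφ
    obtain ⟨va, hva, -⟩ := (HA v₅).2 ⟨φ₁, hφ₁, hS2T.2 hT, hL₁⟩
    have hvab : va ≫ ja ≫ j₅ = b := by rw [← Category.assoc, hva, hv₅]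
    subst hvab
    refine ⟨va, rfl, ?_⟩
    -- through `W`
    obtain ⟨w, hw⟩ := (hVI va).2 hVI'
    exact ⟨w, hw, fun w' hw' => (cancel_mono W.ι).1 (hw'.trans hw.symm)⟩

/-! ### §2 The tower (hypothesis-free: the (S2) transport is ★ `DescendedHomBaseChangeComp`) -/

include hF f hg hD hL₀ hamp hN hδ in
/-- **THE MFK LOCUS TOWER (steps (III)–(VI)) OF AN ABELIAN SCHEME** ([MumfordFogartyKirwan1994] Prop. 7.3, proof, steps
(III)–(VI), with App. 7A's type / symplectic-liftability clopen step after the polarisation exists): for `A → S` of relative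
dimension `g` over `S` locally of finite type over a countable field of characteristic `0`, a dual pair `D` with its unit
clause, a rank-one `L₀` on `A` ample on geometric fibres, `2g` sections `σᵢ`, `N ≠ 0`, a polarisation type `δ` and a frame
`u : 𝒪_S^{6^g·deg δ} → π_*L₀`: there are the classifying homomorphism `Λ(L′)` of `L′ = L₀ ⊗ π^*(ε^*L₀)^∨` and an IMMERSION
`j : H ⟶ S` such that `b : T ⟶ S` (`T` locally Noetherian) factors through `j` — and then uniquely — iff on `A ×_S T`: (V) there are a
homomorphism `ω` with `[6] ≫ ω = Λ(L′)_T` and `L′_T ≅ L^Δ_T(ω)^{⊗3}` (graph `Γ₁`), (P)+(V′) a polarisation with `lam = ω` of type `δ`,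
(III)+(IV)+(V′) the `σᵢ ×_S T` are a level-`N` structure symplectic-liftable of type `δ` for it, and (VI) `b^*u ≫ β` is an
isomorphism («the embedding is the complete linear system»).  = §1 with the (S2) transport ★
`hasType_iff_and_exists_isSymplecticLiftable_iff_of_pow_six_comp_eq` (`DescendedHomBaseChangeComp`, B-p12 (g16)).
[cite: MumfordFogartyKirwan1994, Ch. 7 §2 Proposition 7.3 (pp. 132–134)]
[cite: MumfordFogartyKirwan1994, Ch. 7 §2 Proposition 7.3 (pp. 133–134) and App. 7A (pp. 234–235)]
[cite: Lan2013PELCompactifications, §1.3.6 Lemma 1.3.6.6 and Cor. 1.3.6.7 (pp. 81–82)] -/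
theorem exists_isImmersion_iff_mfkLocus :
    ∃ (lam : A.X ⟶ D.hat.X) (_ : IsMonHom lam)
      (_ : ∀ ⦃U : Over S⦄ (a : U ⟶ A.X),
        Nonempty ((Scheme.Modules.pullback (A.X ◁ (a ≫ lam)).left).obj D.P ≅
          (Scheme.Modules.pullback (A.X ◁ a).left).obj (A.mumfordBundle
            (tensorObj L₀ ((Scheme.Modules.pullback A.X.hom).obj
              (Modules.dual ((Scheme.Modules.pullback A.unitSection).obj L₀)))))))
      (H : Scheme.{0}) (j : H ⟶ S), IsImmersion j ∧
      ∀ ⦃T : Scheme.{0}⦄ [IsLocallyNoetherian T] (b : T ⟶ S),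
        (∃! v : T ⟶ H, v ≫ j = b) ↔
          ∃ (ω : (A.baseChange b).X ⟶ (D.hat.baseChange b).X) (Γ₁ : (A.baseChange b).left ⟶ A.prodLeft D.hat),
            IsMonHom ω ∧ ((𝟙 (A.baseChange b).X) ^ 6) ≫ ω = (Over.pullback b).map lam ∧
              Γ₁ ≫ pullback.fst A.X.hom D.hat.X.hom = pullback.fst A.X.hom b ∧
              Γ₁ ≫ pullback.snd A.X.hom D.hat.X.hom = ω.left ≫ pullback.fst D.hat.X.hom b ∧
              Nonempty ((Scheme.Modules.pullback (pullback.fst A.X.hom b)).obj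
                  (tensorObj L₀ ((Scheme.Modules.pullback A.X.hom).obj
                    (Modules.dual ((Scheme.Modules.pullback A.unitSection).obj L₀)))) ≅
                tensorPow ((Scheme.Modules.pullback Γ₁).obj D.P) 3) ∧
              ∃ pol : (A.baseChange b).Polarization (D.baseChange b), pol.lam = ω ∧ pol.HasType δ ∧
                (∃ φ : LevelStructure g N (A.baseChange b),
                  (∀ i, φ.σ i = A.sectionBaseChange b (σ i)) ∧ φ.IsSymplecticLiftable pol δ) ∧
                IsIso ((Scheme.Modules.pullback b).map u ≫
                  pushforwardBaseChangeHom (IsPullback.of_hasPullback A.X.hom b).w L₀) :=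
  exists_isImmersion_iff_mfkLocus_of_transport hF f A hg D hD L₀ hL₀ hamp hN δ hδ σ u
    fun _ _ _ j v b hb lam _ pol₁ h₁ pol h =>
      A.hasType_iff_and_exists_isSymplecticLiftable_iff_of_pow_six_comp_eq D lam
        (fun s => by exact_mod_cast forall_natCast_residueField_ne_zero_of_over_field f 6 (by norm_num) s)
        hb pol₁ h₁ pol h δ σ

end Tower

/-! ### §3 (T3) The universal object over the locus (F-8 (8α) `univ`) -/

section Univ

variable {S : Scheme.{0}} (A : AbelianSchemeOver S) {g : ℕ} (D : A.DualPair) (L₀ : A.left.Modules) {N : ℕ}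
  (δ : Fin g → ℕ) (σ : Fin g ⊕ Fin g → A.Sections)
  (u : freeModule S (Fin (6 ^ g * polarizationDegree δ)) ⟶ (Scheme.Modules.pushforward A.X.hom).obj L₀)
  (lam : A.X ⟶ D.hat.X) {H : Scheme.{0}} (j : H ⟶ S)

/-- **(T3) THE UNIVERSAL OBJECT OVER THE LOCUS.**  If `j : H ⟶ S` is a monomorphism from a locally Noetherian `H` with the
universal property of §1 (for the clause `P(b)` of `exists_isImmersion_iff_mfkLocus_of_transport`), then `P(j)` holds: over
`H` there are the sixth root `ω_H` of `Λ(L′)_H` with its graph and cube isomorphism, a polarisation `pol_H` of `A ×_S H` with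
`pol_H.lam = ω_H` of type `δ`, the level-`N` structure `φ_H = σ ×_S H`, symplectic-liftable of type `δ`, and the frame clause —
so that `⟨A.baseChange j, hg.baseChange j, D.baseChange j, pol_H, ‹type›, φ_H, ‹liftable›⟩ : PolarizedAbelianSchemeWithLevel g N δ H`
is the universal polarised abelian scheme with level structure over the locus ([MumfordFogartyKirwan1994] p. 134 «`Z₅` has a
polarization `ω̄₅`», Def. 7.5's `univ` of F-8 (8α)).  (The iff at `b := j`, `v := 𝟙`.) [cite: MumfordFogartyKirwan1994, Ch. 7 §2 Proposition 7.3 (pp. 132–134)]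
[cite: MumfordFogartyKirwan1994, Ch. 7 §2 Definition 7.2 (p. 129)] -/
theorem mfkLocus_self_of_forall_iff [Mono j] [IsLocallyNoetherian H]
    (huniv : ∀ ⦃T : Scheme.{0}⦄ [IsLocallyNoetherian T] (b : T ⟶ S),
      (∃! v : T ⟶ H, v ≫ j = b) ↔
        ∃ (ω : (A.baseChange b).X ⟶ (D.hat.baseChange b).X) (Γ₁ : (A.baseChange b).left ⟶ A.prodLeft D.hat),
          IsMonHom ω ∧ ((𝟙 (A.baseChange b).X) ^ 6) ≫ ω = (Over.pullback b).map lam ∧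
            Γ₁ ≫ pullback.fst A.X.hom D.hat.X.hom = pullback.fst A.X.hom b ∧
            Γ₁ ≫ pullback.snd A.X.hom D.hat.X.hom = ω.left ≫ pullback.fst D.hat.X.hom b ∧
            Nonempty ((Scheme.Modules.pullback (pullback.fst A.X.hom b)).obj
                (tensorObj L₀ ((Scheme.Modules.pullback A.X.hom).obj
                  (Modules.dual ((Scheme.Modules.pullback A.unitSection).obj L₀)))) ≅
              tensorPow ((Scheme.Modules.pullback Γ₁).obj D.P) 3) ∧
            ∃ pol : (A.baseChange b).Polarization (D.baseChange b), pol.lam = ω ∧ pol.HasType δ ∧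
              (∃ φ : LevelStructure g N (A.baseChange b),
                (∀ i, φ.σ i = A.sectionBaseChange b (σ i)) ∧ φ.IsSymplecticLiftable pol δ) ∧
              IsIso ((Scheme.Modules.pullback b).map u ≫
                pushforwardBaseChangeHom (IsPullback.of_hasPullback A.X.hom b).w L₀)) :
    ∃ (ω : (A.baseChange j).X ⟶ (D.hat.baseChange j).X) (Γ₁ : (A.baseChange j).left ⟶ A.prodLeft D.hat),
      IsMonHom ω ∧ ((𝟙 (A.baseChange j).X) ^ 6) ≫ ω = (Over.pullback j).map lam ∧
        Γ₁ ≫ pullback.fst A.X.hom D.hat.X.hom = pullback.fst A.X.hom j ∧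
        Γ₁ ≫ pullback.snd A.X.hom D.hat.X.hom = ω.left ≫ pullback.fst D.hat.X.hom j ∧
        Nonempty ((Scheme.Modules.pullback (pullback.fst A.X.hom j)).obj
            (tensorObj L₀ ((Scheme.Modules.pullback A.X.hom).obj
              (Modules.dual ((Scheme.Modules.pullback A.unitSection).obj L₀)))) ≅
          tensorPow ((Scheme.Modules.pullback Γ₁).obj D.P) 3) ∧
        ∃ pol : (A.baseChange j).Polarization (D.baseChange j), pol.lam = ω ∧ pol.HasType δ ∧
          (∃ φ : LevelStructure g N (A.baseChange j),
            (∀ i, φ.σ i = A.sectionBaseChange j (σ i)) ∧ φ.IsSymplecticLiftable pol δ) ∧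
          IsIso ((Scheme.Modules.pullback j).map u ≫
            pushforwardBaseChangeHom (IsPullback.of_hasPullback A.X.hom j).w L₀) :=
  (huniv j).1 ⟨𝟙 H, Category.id_comp _, fun _ hv => (cancel_mono j).1 (hv.trans (Category.id_comp _).symm)⟩

end Univ

end AbelianSchemeOver

end Literature.AlgebraicGeometry.AbelianSchemes

end
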